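import Summits.ABC.IUTFork.Conditional.Layer5OfSV05
import Literature.IUT.HodgeTheaters.GlobalFrobenioidsCoricFieldLevelNonVacuity
import HarnessLib

/-!
# Layer-5 certificate, row `IUTchI:Ex5.1(v)` — NV ANNEX A2: the hypothesis list of the item of record
# `layer5_held_ex51v_v5_fieldLevel` is JOINTLY INHABITED and the certificate theorem FIRES there (proof-only)

Cell abc-iut, director-abc (C2) layer certificates; `Summits/ABC/IUTFork/Conditional/Layer5OfSV05.lean` (abc-iut-L5-d1),
theorem `Summit.ABC.IUTFork.Conditional.layer5_held_ex51v_v5_fieldLevel` = E51/L29 (∞κ) at FIELD LEVEL: 9 hypotheses —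
datum side conditions `hroot`, `hprim`, `h1`, `hpow` and laws `h_Ex51v_div` (E51/L26, Kummer theory of the fixed
fields), `h_Ex51v_ordmul`, `h_Ex51v_polex`, `h_Ex51v_zero` ([IUTchI] Example 5.1 (v), kurims manuscript May 2020,
pp. 127–128) [claim: Mochizuki2012, status: disputed].  abc-iut-L5-lead gen 5 GO 10:30:55Z / gen 6 RULINGS #56 (4).

`layer5_held_ex51v_v5_fieldLevel_inhabited`: ∃ (`N`, `X`, `ord`) with NON-commutative `π₁^rat(†𝒟^⊛)` at which the 9
hypotheses hold (abc-iut-w4-d050's `NFBridgeRecon.CoricLawsToy.exists_ex51v_v5_fieldLevel_binders`,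
`GlobalFrobenioidsCoricFieldLevelNonVacuity.lean`: `K_rat := ℚ̄`, `π₁^rat := G_ℚ`, `𝕄^⊛_∞κ` := the root-closure of the
powers of `2`, `ord := v₂`; `h_Ex51v_div` from the classical `Literature.NumberTheory.NumberFields.eq_one_of_forall_exists_pow_eq`)
AND the conclusion `ExistsUniqueCoricStructure N.piRat N.infκPair` obtained by APPLYING `layer5_held_ex51v_v5_fieldLevel`
to them (shape check by name).

HONEST FRAMING.  NV annex: the binder list of `layer5_held_ex51v_v5_fieldLevel` is JOINTLY INHABITED at a toy with
GENUINE Galois side (`ℚ̄ ↶ G_ℚ`, non-abelian) and DEGENERATE function-field side — inhabited ≠ discharged; this changes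
no cert census and no cone token; not a claim about the genuine `Gal(L̄_C/L_C)`-datum; nothing of [IUTchI] asserted or
denied; no side is taken on [IUTchIII] Cor. 3.12.  PROOF-ONLY: no `def`, no `instance`, no `structure`, no new Prop fact;
nothing of the certificate modules is edited (abc-iut-L5-d1 stays the only writer of cert versions).
-/

namespace Summit.ABC.IUTFork.Conditional

open Literature.IUT.HodgeTheaters

/-- **NV annex A2.**  The nine hypotheses of `layer5_held_ex51v_v5_fieldLevel` are jointly inhabited at the Galois toy
`ℚ̄ ↶ G_ℚ` (non-commutative `π₁^rat`), and the certificate theorem fires there.  Inhabited ≠ discharged; no census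
change. ([IUTchI] Ex 5.1 (v) pp.127–128) [claim: Mochizuki2012, status: disputed] -/
theorem layer5_held_ex51v_v5_fieldLevel_inhabited :
    ∃ (N : NFBridgeRecon.{0}) (X : Type) (ord : X → N.Krat → ℤ),
      (∃ a b : N.piRat, a * b ≠ b * a) ∧
      ((∀ a : N.Krat, a ≠ 0 → ∀ n : ℕ, 0 < n → ∃ b : N.Krat, b ^ n = a) ∧
      (∀ n : ℕ, 0 < n → ∃ ζ : N.Krat, IsPrimitiveRoot ζ n) ∧
      (1 : N.Krat) ∈ N.Minfκ ∧
      (∀ (f : N.Krat) (n : ℕ), 0 < n → (f ∈ N.Minfκ ↔ f ^ n ∈ N.Minfκ)) ∧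
      (∀ (H : OpenNormalSubgroup N.piRat) (a : N.Krat), a ≠ 0 → (∀ h : N.piRat, h ∈ H → h • a = a) →
        (∀ n : ℕ+, ∃ b : N.Krat, (∀ h : N.piRat, h ∈ H → h • b = b) ∧ b ^ (n : ℕ) = a) → a = 1) ∧
      (∀ (x : X) (a b : N.Krat), a ≠ 0 → b ≠ 0 → (∀ g : N.piRat, g • a = a) → (∀ g : N.piRat, g • b = b) →
        ord x (a * b) = ord x a + ord x b) ∧
      (∀ f' ∈ N.Minfκx, (∀ g : N.piRat, g • f' = f') →
        ∀ x₁ x₂ : X, x₁ ≠ x₂ → ¬ (ord x₁ f' < 0 ∧ ord x₂ f' < 0)) ∧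
      (∃ f ∈ N.Minfκ, (∀ g : N.piRat, g • f = f) ∧ ∃ x₁ x₂ : X, x₁ ≠ x₂ ∧ 0 < ord x₁ f ∧ 0 < ord x₂ f)) ∧
      ExistsUniqueCoricStructure N.piRat N.infκPair := by
  obtain ⟨N, X, ord, hne, hroot, hprim, h1, hpow, hdiv, hordmul, hpolex, hzero⟩ :=
    NFBridgeRecon.CoricLawsToy.exists_ex51v_v5_fieldLevel_binders
  exact ⟨N, X, ord, hne, ⟨hroot, hprim, h1, hpow, hdiv, hordmul, hpolex, hzero⟩,
    layer5_held_ex51v_v5_fieldLevel N hroot hprim h1 hpow hdiv ord hordmul hpolex hzero⟩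

end Summit.ABC.IUTFork.Conditional
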